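import Literature.MathematicalPhysics.StatisticalMechanics.BarlowStacking

/-!
# Negative knowledge for crux `SpectralChargeLedger.OneMultiplierPricing` (stmt-AtomisticToContinuum-17253), I:
# first shells of relaxed Barlow stackings and the matching defect under dilation

Part I (`--supports stmt-AtomisticToContinuum-17253`; used by
`Theorems/SpectralChargeLedgerOneMultiplierPricingRefutation.lean`). All `[folklore]`.

* `norm_barlowPos_sq`, `haggLabel_small` — coordinates;
* **`norm_le_of_mem_barlowStacking`** — shell enumeration (norm part): for in-layer spacing
  `a ∈ [47/50, 1]` and layer spacing `h` with `|h − a√(2/3)| ≤ a/100`, every non-zero point of a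
  Hägg stacking `barlowStacking a h s` of norm `< 13/10·a` has norm `a` (six in-layer neighbours)
  or `√(a²/3 + h²)` (six adjacent-layer neighbours), hence norm `≤ max a √(a²/3 + h²)`;
* `norm_barlowPos_010`, `norm_barlowPos_100` — both values are attained (in hcp AND fcc);
* **`dilation_defect`** — if the punctured `13/10·a`-shell of a site is `τ`-matched (linear
  isometry + bijection, the matching format of the crux) to a reference set containing a point of
  norm `ρ`, then in the uniformly dilated configuration `(1+s)•y` the same site is `τ'`-matched to
  a reference set with all norms `≤ ρ` only if `τ' ≥ (1+s)(ρ − τ) − ρ`.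
-/

noncomputable section

open scoped BigOperators
open Literature.MathematicalPhysics.StatisticalMechanics

namespace Summit.AtomisticToContinuum.Crystallization.Theorems.OneMultiplierPricing.Negative.BarlowShellDilation

/-- Squared norm of a stacking point in terms of the indices and the layer label. [folklore] -/
theorem norm_barlowPos_sq (a h : ℝ) (s : ℤ → ℤ) (k i j : ℤ) :
    ‖barlowPos a h s k i j‖ ^ 2 =
      a ^ 2 * ((i : ℝ) ^ 2 + (i : ℝ) * j + (j : ℝ) ^ 2 + (haggLabel s k : ℝ) * ((i : ℝ) + j) +
        (haggLabel s k : ℝ) ^ 2 / 3) + (k : ℝ) ^ 2 * h ^ 2 := by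
  have h0 : barlowPos a h s 0 0 0 = 0 := by
    simp [barlowPos]
  have h3 : (Real.sqrt 3 : ℝ) ^ 2 = 3 := Real.sq_sqrt (by norm_num)
  rw [← dist_zero_right, ← h0, dist_barlowPos_sq]
  simp only [haggLabel_zero, Int.cast_zero, sub_zero]
  linear_combination (a ^ 2 / 4 * ((j : ℝ) + (haggLabel s k : ℝ) / 3) ^ 2) * h3

/-- Layer labels of a Hägg sequence at `k = 0, ±1`. [folklore] -/
theorem haggLabel_small {s : ℤ → ℤ} (hs : IsHaggSeq s) {k : ℤ} (hk : k ^ 2 ≤ 1) :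
    (k = 0 ∧ haggLabel s k = 0) ∨ (k ^ 2 = 1 ∧ (haggLabel s k = 1 ∨ haggLabel s k = -1)) := by
  have hk1 : -1 ≤ k ∧ k ≤ 1 := by constructor <;> nlinarith
  have hcase : k = 0 ∨ k = 1 ∨ k = -1 := by omega
  rcases hcase with rfl | rfl | rfl
  · exact Or.inl ⟨rfl, haggLabel_zero s⟩
  · right
    refine ⟨by norm_num, ?_⟩
    have h1 : haggLabel s 1 = s 0 := by
      have := haggLabel_succ s 0
      simpa using this
    rw [h1]; exact hs 0
  · right
    refine ⟨by norm_num, ?_⟩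
    have h1 : haggLabel s (-1) = - s (-1) := by
      have := haggLabel_succ s (-1)
      simp at this
      linarith
    rw [h1]
    rcases hs (-1) with h2 | h2 <;> simp [h2]

/-- **Shell enumeration (norm part).** For a Hägg stacking with in-layer spacing `a ∈ [47/50, 1]`
and layer spacing `h` within `a/100` of the ideal `a√(2/3)`, every non-zero stacking point of norm
`< 13/10·a` has norm `a` (six in-layer neighbours) or `√(a²/3 + h²)` (six adjacent-layer
neighbours); in particular its norm is at most `max a √(a²/3 + h²)`. [folklore] -/
theorem norm_le_of_mem_barlowStacking {a h : ℝ} (ha : 47 / 50 ≤ a)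
    (hh : |h - a * Real.sqrt (2 / 3)| ≤ a / 100) {s : ℤ → ℤ} (hs : IsHaggSeq s)
    {p : (EuclideanSpace ℝ (Fin 3))} (hp : p ∈ barlowStacking a h s) (hpn : ‖p‖ < 13 / 10 * a) :
    ‖p‖ ≤ max a (Real.sqrt (a ^ 2 / 3 + h ^ 2)) := by
  obtain ⟨k, i, j, rfl⟩ := hp
  have ha0 : 0 < a := by linarith
  -- bounds on h
  have hs23 : (4 : ℝ) / 5 < Real.sqrt (2 / 3) := by
    rw [show (4 : ℝ) / 5 = Real.sqrt ((4 / 5) ^ 2) by rw [Real.sqrt_sq (by norm_num)]]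
    exact Real.sqrt_lt_sqrt (by norm_num) (by norm_num)
  have hhlo : 79 / 100 * a ≤ h := by
    have := (abs_le.1 hh).1
    nlinarith
  have hh0 : 0 < h := by nlinarith
  have hh2 : 6241 / 10000 * a ^ 2 ≤ h ^ 2 := by nlinarith
  have hnsq := norm_barlowPos_sq a h s k i j
  have hn0 : 0 ≤ ‖barlowPos a h s k i j‖ := norm_nonneg _
  have hnsq_lt : ‖barlowPos a h s k i j‖ ^ 2 < (13 / 10 * a) ^ 2 := by
    exact pow_lt_pow_left₀ hpn hn0 two_ne_zero
  set L : ℤ := haggLabel s k with hL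
  -- the in-layer quadratic part is non-negative
  have hform : 0 ≤ (i : ℝ) ^ 2 + (i : ℝ) * j + (j : ℝ) ^ 2 + (L : ℝ) * ((i : ℝ) + j) + (L : ℝ) ^ 2 / 3 := by
    nlinarith [sq_nonneg ((i : ℝ) + (j : ℝ) / 2 + (L : ℝ) / 2), sq_nonneg ((j : ℝ) + (L : ℝ) / 3)]
  by_cases hk : k ^ 2 ≤ 1
  · rcases haggLabel_small hs hk with ⟨rfl, hL0⟩ | ⟨hk1, hL1⟩
    · -- k = 0: norm² = a² (i² + ij + j²), an integer multiple of a², < 1.69 a² ⇒ ≤ a²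
      have hL0' : (L : ℝ) = 0 := by rw [hL, hL0]; simp
      set q : ℤ := i ^ 2 + i * j + j ^ 2 with hq
      have hnsq' : ‖barlowPos a h s 0 i j‖ ^ 2 = a ^ 2 * (q : ℝ) := by
        rw [hnsq, hL0', hq]; push_cast; ring
      have hqlt : (q : ℝ) < 2 := by
        by_contra hcon
        have hcon' : (2 : ℝ) ≤ q := not_lt.mp hcon
        have : a ^ 2 * 2 ≤ a ^ 2 * (q : ℝ) := by nlinarith
        nlinarith
      have hq1 : q ≤ 1 := by
        have : q < 2 := by exact_mod_cast hqlt
        omega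
      have hq1' : (q : ℝ) ≤ 1 := by exact_mod_cast hq1
      have hle : ‖barlowPos a h s 0 i j‖ ^ 2 ≤ a ^ 2 := by rw [hnsq']; nlinarith
      calc ‖barlowPos a h s 0 i j‖ ≤ a := by
            exact (pow_le_pow_iff_left₀ hn0 ha0.le two_ne_zero).1 (by simpa using hle)
        _ ≤ max a (Real.sqrt (a ^ 2 / 3 + h ^ 2)) := le_max_left _ _
    · -- k = ±1: norm² = a² (m + 1/3) + h² with m a non-negative integer ⇒ m = 0
      have hk1' : (k : ℝ) ^ 2 = 1 := by exact_mod_cast hk1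
      have hL1' : L = 1 ∨ L = -1 := by rw [hL]; exact hL1
      have hLsq : (L : ℝ) ^ 2 = 1 := by
        rcases hL1' with h1 | h1 <;> rw [h1] <;> norm_num
      set m : ℤ := i ^ 2 + i * j + j ^ 2 + L * (i + j) with hm
      have hm0 : 0 ≤ m := by
        rcases hL1' with h1 | h1
        · have : 2 * m + 1 = (i + j + 1) ^ 2 + i ^ 2 + j ^ 2 := by rw [hm, h1]; ring
          nlinarith [sq_nonneg (i + j + 1), sq_nonneg i, sq_nonneg j]
        · have : 2 * m + 1 = (i + j - 1) ^ 2 + i ^ 2 + j ^ 2 := by rw [hm, h1]; ring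
          nlinarith [sq_nonneg (i + j - 1), sq_nonneg i, sq_nonneg j]
      have hnsq' : ‖barlowPos a h s k i j‖ ^ 2 = a ^ 2 * (m : ℝ) + (a ^ 2 / 3 + h ^ 2) := by
        rw [hnsq, hm]; push_cast
        linear_combination (a ^ 2 / 3) * hLsq + h ^ 2 * hk1'
      have hmlt : (m : ℝ) < 1 := by
        by_contra hcon
        have hcon' : (1 : ℝ) ≤ m := not_lt.mp hcon
        have : a ^ 2 * 1 ≤ a ^ 2 * (m : ℝ) := by nlinarith
        nlinarith
      have hm1 : m = 0 := by
        have : m < 1 := by exact_mod_cast hmlt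
        omega
      have hm1' : (m : ℝ) = 0 := by exact_mod_cast hm1
      have heq : ‖barlowPos a h s k i j‖ ^ 2 = a ^ 2 / 3 + h ^ 2 := by rw [hnsq', hm1']; ring
      have : ‖barlowPos a h s k i j‖ = Real.sqrt (a ^ 2 / 3 + h ^ 2) := by
        rw [← heq, Real.sqrt_sq hn0]
      rw [this]
      exact le_max_right _ _
  · -- |k| ≥ 2: norm ≥ 2h > 13/10·a
    exfalso
    have hk2 : (4 : ℤ) ≤ k ^ 2 := by
      rcases le_or_gt 2 k with h2 | h2
      · nlinarith
      rcases le_or_gt k (-2) with h3 | h3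
      · nlinarith
      exfalso
      apply hk
      have hk1 : -1 ≤ k ∧ k ≤ 1 := by omega
      nlinarith [hk1.1, hk1.2]
    have hk4 : (4 : ℝ) ≤ (k : ℝ) ^ 2 := by exact_mod_cast hk2
    have : (k : ℝ) ^ 2 * h ^ 2 ≤ ‖barlowPos a h s k i j‖ ^ 2 := by
      rw [hnsq]; nlinarith
    nlinarith

/-- The two reference points `u = (a,0,0)` and the adjacent-layer neighbour above the origin have
norms `a` and `√(a²/3+h²)`. [folklore] -/
theorem norm_barlowPos_010 {a : ℝ} (ha : 0 ≤ a) (h : ℝ) (s : ℤ → ℤ) :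
    ‖barlowPos a h s 0 1 0‖ = a := by
  have hsq := norm_barlowPos_sq a h s 0 1 0
  simp only [haggLabel_zero, Int.cast_zero, Int.cast_one] at hsq
  have : ‖barlowPos a h s 0 1 0‖ ^ 2 = a ^ 2 := by rw [hsq]; ring
  rw [← Real.sqrt_sq (norm_nonneg _), this, Real.sqrt_sq ha]

/-- The adjacent-layer neighbour above the origin has norm `√(a²/3+h²)`. [folklore] -/
theorem norm_barlowPos_100 {a h : ℝ} {s : ℤ → ℤ} (hs : IsHaggSeq s) :
    ‖barlowPos a h s 1 0 0‖ = Real.sqrt (a ^ 2 / 3 + h ^ 2) := by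
  have hsq := norm_barlowPos_sq a h s 1 0 0
  have h1 : haggLabel s 1 = s 0 := by
    have := haggLabel_succ s 0
    simpa using this
  have hLsq : (haggLabel s 1 : ℝ) ^ 2 = 1 := by
    rw [h1]; rcases hs 0 with h2 | h2 <;> simp [h2]
  simp only [Int.cast_zero, Int.cast_one] at hsq
  have : ‖barlowPos a h s 1 0 0‖ ^ 2 = a ^ 2 / 3 + h ^ 2 := by
    rw [hsq]; linear_combination (a ^ 2 / 3) * hLsq
  rw [← Real.sqrt_sq (norm_nonneg _), this]


/-- **Matching defect under dilation.** If the punctured `13/10·a`-shell of site `i` of `y` is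
`τ`-matched (after a linear isometry, bijectively) to a reference set all of whose points have norm
`≤ ρ` and one of which has norm exactly `ρ`, then in the dilated configuration `(1+s) • y` the
same site cannot be `τ'`-matched to any reference set with norms `≤ ρ` unless
`τ' ≥ (1+s)(ρ-τ) - ρ`: the preimage of the extremal reference point is carried to norm
`≥ (1+s)(ρ - τ)`, out of reach of every reference point. [folklore] -/
theorem dilation_defect {N : ℕ} (y : Fin N → (EuclideanSpace ℝ (Fin 3))) (i : Fin N) {a ρ τ τ' s : ℝ}
    (T T' : Set (EuclideanSpace ℝ (Fin 3))) (hT : ∃ p ∈ T, ‖p‖ = ρ) (hT' : ∀ p ∈ T', ‖p‖ ≤ ρ)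
    (hs : 0 ≤ s) (hfit : (1 + s) * (ρ + τ) < 13 / 10 * a)
    (A : (EuclideanSpace ℝ (Fin 3)) →ₗᵢ[ℝ] (EuclideanSpace ℝ (Fin 3)))
    (e : ↥{z : (EuclideanSpace ℝ (Fin 3)) | z ∈ Set.range y ∧ z ≠ y i ∧ dist z (y i) < 13 / 10 * a} ≃ ↥T)
    (he : ∀ t : ↥{z : (EuclideanSpace ℝ (Fin 3)) | z ∈ Set.range y ∧ z ≠ y i ∧ dist z (y i) < 13 / 10 * a},
      dist ((t : (EuclideanSpace ℝ (Fin 3))) - y i) (A (e t : (EuclideanSpace ℝ (Fin 3)))) ≤ τ)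
    (A' : (EuclideanSpace ℝ (Fin 3)) →ₗᵢ[ℝ] (EuclideanSpace ℝ (Fin 3)))
    (e' : ↥{z : (EuclideanSpace ℝ (Fin 3)) | z ∈ Set.range (fun j => (1 + s) • y j) ∧ z ≠ (1 + s) • y i ∧
        dist z ((1 + s) • y i) < 13 / 10 * a} ≃ ↥T')
    (he' : ∀ t : ↥{z : (EuclideanSpace ℝ (Fin 3)) | z ∈ Set.range (fun j => (1 + s) • y j) ∧ z ≠ (1 + s) • y i ∧
        dist z ((1 + s) • y i) < 13 / 10 * a},
      dist ((t : (EuclideanSpace ℝ (Fin 3))) - (1 + s) • y i) (A' (e' t : (EuclideanSpace ℝ (Fin 3)))) ≤ τ') :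
    (1 + s) * (ρ - τ) - ρ ≤ τ' := by
  obtain ⟨p₀, hp₀T, hp₀⟩ := hT
  set t₀ := e.symm ⟨p₀, hp₀T⟩ with ht₀
  have het₀ : (e t₀ : (EuclideanSpace ℝ (Fin 3))) = p₀ := by rw [ht₀, Equiv.apply_symm_apply]
  have h1 : dist ((t₀ : (EuclideanSpace ℝ (Fin 3))) - y i) (A p₀) ≤ τ := by simpa [het₀] using he t₀
  have h1' : ‖(t₀ : (EuclideanSpace ℝ (Fin 3))) - y i - A p₀‖ ≤ τ := by rwa [dist_eq_norm] at h1
  have hAp₀ : ‖A p₀‖ = ρ := by rw [LinearIsometry.norm_map, hp₀]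
  -- the preimage of the extremal point has norm within τ of ρ
  have hlo : ρ - τ ≤ ‖(t₀ : (EuclideanSpace ℝ (Fin 3))) - y i‖ := by
    have h := norm_sub_norm_le (A p₀) ((t₀ : (EuclideanSpace ℝ (Fin 3))) - y i)
    have h' : ‖A p₀ - ((t₀ : (EuclideanSpace ℝ (Fin 3))) - y i)‖ = ‖(t₀ : (EuclideanSpace ℝ (Fin 3))) - y i - A p₀‖ := norm_sub_rev _ _
    linarith
  have hhi : ‖(t₀ : (EuclideanSpace ℝ (Fin 3))) - y i‖ ≤ ρ + τ := by
    have := norm_sub_norm_le ((t₀ : (EuclideanSpace ℝ (Fin 3))) - y i) (A p₀)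
    linarith
  -- its dilate lies in the shell of the dilated configuration
  obtain ⟨⟨j₀, hj₀⟩, hne, -⟩ := t₀.2
  have hs1 : (0 : ℝ) < 1 + s := by linarith
  have hmem : (1 + s) • (t₀ : (EuclideanSpace ℝ (Fin 3))) ∈ {z : (EuclideanSpace ℝ (Fin 3)) | z ∈ Set.range (fun j => (1 + s) • y j) ∧
      z ≠ (1 + s) • y i ∧ dist z ((1 + s) • y i) < 13 / 10 * a} := by
    refine ⟨⟨j₀, by simp [hj₀]⟩, ?_, ?_⟩
    · intro h
      exact hne (smul_right_injective (EuclideanSpace ℝ (Fin 3)) hs1.ne' h)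
    · rw [dist_smul₀, Real.norm_eq_abs, abs_of_pos hs1, dist_eq_norm]
      calc (1 + s) * ‖(t₀ : (EuclideanSpace ℝ (Fin 3))) - y i‖ ≤ (1 + s) * (ρ + τ) :=
            mul_le_mul_of_nonneg_left hhi hs1.le
        _ < 13 / 10 * a := hfit
  have h2 := he' ⟨(1 + s) • (t₀ : (EuclideanSpace ℝ (Fin 3))), hmem⟩
  have h3 : ‖(A' (e' ⟨(1 + s) • (t₀ : (EuclideanSpace ℝ (Fin 3))), hmem⟩ : (EuclideanSpace ℝ (Fin 3))))‖ ≤ ρ := by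
    rw [LinearIsometry.norm_map]
    exact hT' _ (e' ⟨(1 + s) • (t₀ : (EuclideanSpace ℝ (Fin 3))), hmem⟩).2
  have h4 : ‖(1 + s) • (t₀ : (EuclideanSpace ℝ (Fin 3))) - (1 + s) • y i‖ = (1 + s) * ‖(t₀ : (EuclideanSpace ℝ (Fin 3))) - y i‖ := by
    rw [← smul_sub, norm_smul, Real.norm_eq_abs, abs_of_pos hs1]
  have h2' : ‖(1 + s) • (t₀ : (EuclideanSpace ℝ (Fin 3))) - (1 + s) • y i - (A' (e' ⟨(1 + s) • (t₀ : (EuclideanSpace ℝ (Fin 3))), hmem⟩ : (EuclideanSpace ℝ (Fin 3))))‖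
      ≤ τ' := by rwa [dist_eq_norm] at h2
  have h5 : ‖(1 + s) • (t₀ : (EuclideanSpace ℝ (Fin 3))) - (1 + s) • y i‖ ≤ ρ + τ' := by
    have := norm_sub_norm_le ((1 + s) • (t₀ : (EuclideanSpace ℝ (Fin 3))) - (1 + s) • y i)
      (A' (e' ⟨(1 + s) • (t₀ : (EuclideanSpace ℝ (Fin 3))), hmem⟩ : (EuclideanSpace ℝ (Fin 3))))
    linarith
  rw [h4] at h5
  nlinarith [mul_le_mul_of_nonneg_left hlo hs1.le]


end Summit.AtomisticToContinuum.Crystallization.Theorems.OneMultiplierPricing.Negative.BarlowShellDilation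

end
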